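import Summits.BirchSwinnertonDyer.Rank1Residual.X11b.Three.SkinnerZhangSharp
import Summits.BirchSwinnertonDyer.BirchSwinnertonDyer.Theorems.RungK2Hub
import Literature.NumberTheory.EllipticCurves.Rank1Residual.X9NoEntry
import Literature.NumberTheory.EllipticCurves.BSDSelmerSkinnerProofs
import Literature.NumberTheory.EllipticCurves.BSDSelmerPConverseRamifiedProofs

/-!
# Route `ErratumRoadFive` (rung K2a, D-0059) — the KOLYVAGIN ROAD on the Locus, stated over the class record's
# vocabulary (cell `bsd-stepL`, seat `bsd-stepL-koly` g6; `--supports stmt-BirchSwinnertonDyer-19061`)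

Helper for the crux `Theses.ErratumRoadFive.OpenInputIMC` (item 19061; the anticyclotomic-IMC lower bound at
`p ∥ N`, the erratum-currency STEP L): on the Locus `ClassX11b W p ∧ 5 ≤ p ∧ Ram W p ∧ p ∤ ∏ c_ℓ` (class-wide
2 093 111 of the 2 155 109 (ram) pairs N < 5·10⁵ — census of record K-SZ14♯, STATUS 2026-08-25T21:53:59Z) the
Kolyvagin road gives STEP L in INDEX currency — `X11b.IndexLowerBoundAt W p K P` — from the typed statement
`Koly.SkinnerZhangSharp W p K` (`X11b/Three/SkinnerZhangSharp.lean`, p408816; = Skinner–Zhang arXiv:1407.1099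
Thm 1.3 with (c) and ♠(2) replaced by «p ∤ ∏c», memos MEMO-v4 ∕ MEMO-v5.1, referee g17 ∕ g19 PASS) and the
McCallum structure fact — an ALTERNATIVE to `OpenInputIMC` on the Locus that needs no BDP object and no main
conjecture. New here relative to the kernel `Koly.exists_indexLowerBoundAt_of_skinnerZhangSharp_of_mccallum`:
the class record's predicates are UNPACKED (`Surj` from `Irr ∧ Ram`, `surj_of_irr_of_ram`) and the
tower-surjectivity binder `∀ m, ρ̄_{E,p^m} onto` is DISCHARGED by the tree theorem
`hasSurjectiveModNGaloisRep_pow_of_hasMultiplicativeReductionAtPrime` (a unipotent inertia element at the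
ramified multiplicative prime ℓ₀ plus `ρ̄_{E,p}` onto generate `GL₂(ℤ/p^m)`); non-CM from the multiplicative
prime (`not_hasCM_of_hasMultiplicativeReductionAtPrime'`). Nothing new is asserted; CONDITIONAL on `hSZs`
(typed statement, PRE-derived) and `hMc` (LINE-K named fact). The descent `IndexLowerBoundAt → BSDp W p` is
`X11b.bsdp_of_indexLowerBoundAt_of_heegnerData_of_odd` (not composed here).
-/

noncomputable section

open scoped Classical

namespace Summit.BirchSwinnertonDyer.Rank1Residual.X11b.Three.Koly

open WeierstrassCurve Literature.NumberTheory.EllipticCurves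
  Literature.NumberTheory.EllipticCurves.ModularForms
  Literature.NumberTheory.EllipticCurves.Rank1Residual
  Summit.BirchSwinnertonDyer.Rank1Residual Summit.BirchSwinnertonDyer.Rank1Residual.X11b

/-- **The Kolyvagin road on the Locus, class-record vocabulary (supports `OpenInputIMC`).** For `(E, p)` in
class X11b (`r_an = 1`, `p ∥ N` multiplicative, `E[p]` irreducible) with `p ≥ 5`, a (ram) witness and
`p ∤ ∏ c_ℓ`, an imaginary quadratic Heegner field `K` for `N_E` with `d_K ∉ {−3, −4}`, `E(K)` of rank one
without `p`-torsion and `Ш(E/K)` finite: IF `Koly.SkinnerZhangSharp W p K` holds and the McCallum fact `hMc`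
holds, THEN some modular parametrisation datum gives, for its conductor-`1` Kolyvagin–Heegner point `P = y_K`
(of infinite order, `p^{M₀} ∥ P`), the STEP-L inequality `X11b.IndexLowerBoundAt W p K P`
(`2·ord_p[E(K):ℤy_K] ≤ ord_p #Ш(E/K) + 2·ord_p ∏c`). Tower surjectivity is a THEOREM here
(`hasSurjectiveModNGaloisRep_pow_of_hasMultiplicativeReductionAtPrime` from `Surj ∧ Ram`; `Surj` from
`Irr ∧ Ram` by `surj_of_irr_of_ram`). CONDITIONAL on `hSZs`, `hMc`. [folklore]
[cite: McCallumLMS1991, §5 Cor. 5.6 (p. 310)] [cite: SkinnerZhang2014, Thm. 1.3 (§1) — shape of `hSZs` only] -/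
theorem exists_indexLowerBoundAt_of_classX11b_of_skinnerZhangSharp_of_mccallum
    (W : WeierstrassCurve ℚ) [W.IsElliptic] [W.IsGloballyMinimal] [NeZero (W.conductorNorm ℤ)]
    (K : Type) [Field K] [NumberField K] (p : ℕ) [Fact p.Prime]
    (hX : ClassX11b W p) (hp5 : 5 ≤ p) (hram : Ram W p) (htam : ¬ p ∣ W.tamagawaProduct)
    (hSZs : SkinnerZhangSharp W p K) (hMc : McCallum1991_pow_dvd_card_sha_primary_of_certificate)
    (hK : IsImaginaryQuadratic K) (hH : SatisfiesHeegnerHypothesis (W.conductorNorm ℤ) K)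
    (h3 : NumberField.discr K ≠ -3) (h4 : NumberField.discr K ≠ -4)
    (hrank : (W.baseChange K).mordellWeilRank = 1)
    (hiv : ∀ x : (W.baseChange K).toAffine.Point, p • x = 0 → x = 0)
    [Finite (W.baseChange K).sha] :
    ∃ (Dt : ModularParametrizationData W (W.conductorNorm ℤ)) (β : ℤ) (ι : K →+* ℂ),
      ∀ (d₁ : KolyvaginHeegnerData Dt β ι 1) (P : (W.baseChange K).toAffine.Point),
        d₁.toGeomPoints d₁.derivedPoint = toGeomPoints (W.baseChange K) P →
        ¬ IsOfFinAddOrder P →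
        ∀ (M₀ : ℕ), (∃ Q : (W.baseChange K).toAffine.Point, ((p ^ M₀ : ℕ) : ℤ) • Q = P) →
          (¬ ∃ Q : (W.baseChange K).toAffine.Point, ((p ^ (M₀ + 1) : ℕ) : ℤ) • Q = P) →
          IndexLowerBoundAt W p K P := by
  obtain ⟨-, -, hmult, hirr⟩ := hX
  have hρ : Surj W p := surj_of_irr_of_ram W p hirr hram
  have hsurj : ∀ m : ℕ, W.HasSurjectiveModNGaloisRep (p ^ m : ℕ) :=
    hasSurjectiveModNGaloisRep_pow_of_hasMultiplicativeReductionAtPrime W p hρ hram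
  have hCM : ¬ W.HasCM := not_hasCM_of_hasMultiplicativeReductionAtPrime' W hmult
  exact exists_indexLowerBoundAt_of_skinnerZhangSharp_of_mccallum W K p hSZs hMc hp5 hmult hirr hram htam
    hK hH hCM h3 h4 hsurj hrank hiv

end Summit.BirchSwinnertonDyer.Rank1Residual.X11b.Three.Koly

end
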